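import Summits.BirchSwinnertonDyer.BirchSwinnertonDyer.Theses.UniversalToricDescent
import Summits.BirchSwinnertonDyer.BirchSwinnertonDyer.Theorems.UniversalToricDescentDefectTransportModThreePTStubLocalTorsionCountAtTame
import Summits.BirchSwinnertonDyer.BirchSwinnertonDyer.Theorems.UniversalToricDescentDefectTransportModThreePTStubCountOfRelaxedImage
import Summits.BirchSwinnertonDyer.BirchSwinnertonDyer.Theorems.UniversalToricDescentDefectTransportModThreePTStubRelaxedImageCount
import HarnessLib

/-!
# Item TS2-COUNT `TwinSigmaCountAtThree` (stmt-BirchSwinnertonDyer-23850), PROVED — route `UniversalToricDescent`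

The LEAD-promoted stub `stub_twinSigmaCount` of the registered skeleton `Cruxes/DefectTransportModThreePT/Lines/sigmacongruence.lean`
(v7 f98c3df643ce ↦ v9 1bb2faab747a10b8) on the crux ♭T≤ stmt-BirchSwinnertonDyer-23042, as a route item (pen pss3x g7, rev 77):
the `k`-UNIFORM relative Poitou–Tate count for the twin `E′` at a finitely decomposed tame place `v ∉ S` of the anticyclotomic
`ℤ₃`-tower — `#Sel_{𝔭′}^{S}(K_∞)[3^k] · #Φ ≤ C · #Sel_{𝔭′}^{S∪{v}}(K_∞)[3^k]` for every finite set `Φ` of `3^k`-torsion `v`-signatures.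

Proof = the skeleton's derivation (lead `bsd-wall-utd-p1` g18, RELAXED COUNT ROAD), now sorry-free: R2 `stub_countOfRelaxedImage`
(`K_∞`-level assembly through the landed TS1′; width `utd-p1-w2` g1, p686469) fed with R1 `stub_relaxedImageCount` (the layer engine:
one relative Poitou–Tate count between Kummer structures of `E′_{K_m}[3^k]` relaxed above `3`; lead g18) and R3
`stub_localTorsionCountAtTame` (local torsion count at `v`; width `utd-p1-w2` g1/g2, p689873). Width seat `bsd-wall-utd-p1-w2` g4.
THEOREMS ONLY (no definition, no named fact, no `sorry`); the two Poitou–Tate route decls stay HYPOTHESES of the statement.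
BSD is not proved by any of this.

References: [GreenbergVatsal2000] §2 Prop. (2.1), Cor. (2.3) (pp. 23–25); [MilneADT2006] I Thm. 4.10, Thm. 2.6.
-/

-- `…BirchSwinnertonDyer.BirchSwinnertonDyer…` is the problem's mandated namespace (D-0017 nested layout)
set_option linter.dupNamespace false
set_option autoImplicit false

noncomputable section

namespace Summit.BirchSwinnertonDyer.BirchSwinnertonDyer.Theorems

open Summit.BirchSwinnertonDyer.BirchSwinnertonDyer.Cruxes.DefectTransportModThreePT.SigmaCongruence

/-- **Item stmt-BirchSwinnertonDyer-23850 `TwinSigmaCountAtThree` (TS2-COUNT), proved BY NAME**: under the two Poitou–Tate named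
facts of the route, for `E′/ℚ` non-additive at `3`, `K` imaginary quadratic with `3` split, `κ` anticyclotomic, `𝔭 ≠ 𝔭′ ∣ 3`,
`E′(K_∞)[3] = 0`, `S` a finite set of tame finitely decomposed places and one more such `v ∉ S` with `Sel^{ac}_{𝔭′}(S ∪ {v})[3]`
finite, there is `C`, UNIFORM in `k`, with `#Sel^{ac}_{𝔭′}(S)[3^k] · #Φ ≤ C · #Sel^{ac}_{𝔭′}(S ∪ {v})[3^k]` for every finite set `Φ`
of right-`ker κ`-invariant, left-`D_v`-equivariant `3^k`-torsion signatures. Composition R2 ∘ (R1, R3) of the line `sigmacongruence`.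
[cite: GreenbergVatsal2000, §2 Prop. (2.1), Cor. (2.3) (pp. 23–25)] [cite: MilneADT2006, Ch. I, Thm. 4.10, Thm. 2.6] -/
theorem twinSigmaCountAtThree_proof :
    Summit.BirchSwinnertonDyer.BirchSwinnertonDyer.Theses.UniversalToricDescent.TwinSigmaCountAtThree := by
  unfold Summit.BirchSwinnertonDyer.BirchSwinnertonDyer.Theses.UniversalToricDescent.TwinSigmaCountAtThree
  intro hPT hSha W' _ _ K _ _ h3 hK hsp κ hκ γ _ 𝔭 𝔭' h𝔭 h𝔭' hne htor S hS hSd v hv hvS hvd hfin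
  exact stub_countOfRelaxedImage hPT hSha W' K h3 hK hsp κ hκ γ 𝔭 𝔭' h𝔭 h𝔭' hne htor S hS hSd v hv hvS hvd hfin
    (fun v₀ hv₀ hv₀S c d₁ hd₁ hc hdvd ↦
      stub_relaxedImageCount hPT W' K h3 hK hsp κ hκ γ 𝔭 𝔭' h𝔭 h𝔭' hne htor S hS hSd v hv hvS hvd hfin v₀ hv₀ hv₀S c d₁
        hd₁ hc hdvd (stub_localTorsionCountAtTame W' K κ v hv hvd))

end Summit.BirchSwinnertonDyer.BirchSwinnertonDyer.Theorems

end
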